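import Summits.SmoothPoincare4.SmoothPoincare4.Theorems.ConvexBisectionAcyclicBisectionExistsBeltMonodromyPages
import Summits.SmoothPoincare4.SmoothPoincare4.Theorems.ConvexBisectionAcyclicBisectionExistsBeltPageLimit
import Summits.SmoothPoincare4.SmoothPoincare4.Theorems.ConvexBisectionAcyclicBisectionExistsDualHandleBeltMap
import HarnessLib

/-!
# N1 ▸ `node_N1_move` ▸ (d) N1-mono (the deep-belt monodromy model), brick H4-1″:
# THE LEVEL OF THE BELT PAGE ANGLE — seam points of the belt page, or the belt circle
(wave 7, crux stmt-SmoothPoincare4-10508, line `modp-braid-orbits`, registered stub `stub_M2geo` (N1) ▸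
`node_N1_move` ▸ sub-node (d); registered sub-goal `helper_beltLevel_dichotomy`)

Companion of `…BeltMonodromyPages.lean` (off-critical levels) for the CRITICAL level `θ_X = θ_k` of the
boundary open book `θ_X = arg w ∘ Ψ` of `X`, read on `∂X₀` through `G₀ : X₀ ≅ X` (telescope of
`node_N1_move`):

* §1 **deep boundary points are belt-circle points** (`exists_beltCirclePt_of_deep`): a boundary point
  `G₀ (bX.incl y) = D.jB j b` off the base piece `range D.jA` is a point `D.jB j (0, 0, θ)` of the belt
  CIRCLE of handle `j` (deep points have `x_λ = 0`, boundary points have `‖x‖ = 1`); conversely every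
  belt-circle point is such a deep boundary point, over a unique `y ∈ ∂X₀` (`exists_carrier_of_beltCirclePt`);
* §2 **the level of the belt page angle** (`beltLevel_dichotomy`, registered `helper_beltLevel_dichotomy`):
  if no other handle shares the direction of `k`, a point `y ∈ ∂X₀` with `w (Ψ y) ∈ ℝ_{>0} · d k` is EITHER a
  seam point `G₀⁻¹ (D.jA a)` with `w a ∈ ℝ_{>0} · d k`, `a ∈ ∂ Base g` (the base page of direction `d k` off
  the cores, extended to the binding side), OR a belt-circle point `G₀⁻¹ (D.jB k (0,0,θ))` of handle `k` —
  the `σ = 0` slice of the IMAGE/COVER clauses of (d) (`work/stubs/H4H7_interface.lean`): the `∂X`-page of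
  the belt page angle is the base page cut along `γ_k` with the belt circle sewn in.

Everything is proved; no named facts, no `sorry`.  References: A. A. Kosinski, *Differential Manifolds*
(1993), VI §6 [Kosinski1993]; J. Milnor, *Lectures on the h-cobordism theorem* (1965), §3
[MilnorHCobordism1965].
-/

noncomputable section

set_option linter.dupNamespace false

open scoped Manifold ContDiff Topology
open Set Function Metric Complex
open Literature.Topology.FourManifolds Literature.Topology.FourManifolds.HandleAttachingMap
  Literature.Topology.FourManifolds.LefschetzBase

namespace Summit.SmoothPoincare4.SmoothPoincare4.Theorems.AcyclicBisectionExists.ModpBraidOrbits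

/-! ## §1 Deep boundary points are belt-circle points -/

section Deep

variable {g n : ℕ} {h : Fin n → HandleAttachingMap 3 2 (Base g)}
  {X₀ : Type} [TopologicalSpace X₀] [ChartedSpace (EuclideanHalfSpace 4) X₀]
  {X : Type} [TopologicalSpace X] [ChartedSpace (EuclideanHalfSpace 4) X]
  (bX : BoundaryData (𝓡∂ 4) X₀ (𝓡 3)) (G₀ : X₀ ≃ₘ⟮𝓡∂ 4, 𝓡∂ 4⟯ X)
  (D : MultiAttachmentData h (𝓡∂ 4) X)

/-- A point of the closed ball with `x_λ = 0` and `‖x‖ = 1` has `|x_μ| = 1`. [folklore] -/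
theorem muSq_eq_one_of_lamSq_eq_zero {u : EuclideanSpace ℝ (Fin 4)} (h0 : lamSq 2 u = 0) (h1 : ‖u‖ = 1) :
    muSq 2 u = 1 := by
  have hs := lamSq_add_muSq 2 u
  rw [h0, h1, zero_add, one_pow] at hs
  exact hs

/-- **A deep boundary point is a belt-circle point** (brick H4-1″): if `G₀ (bX.incl y) = D.jB j b` is not
a point of the base piece, then `b = (0, 0, θ)` is a point of the belt circle of handle `j`, i.e.
`G₀ (bX.incl y) = D.jB j (beltCirclePt θ) = (beltMap D j).attachingCircle θ`. [cite: Kosinski1993, VI §6] -/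
theorem exists_beltCirclePt_of_deep {y : bX.carrier} {j : Fin n} {b : ↥(beltPiece 3 2)}
    (hy : G₀ (bX.incl y) = D.jB j b) (hdeep : G₀ (bX.incl y) ∉ range D.jA) :
    ∃ θ : sphere (0 : EuclideanSpace ℝ (Fin 2)) 1, beltCirclePt θ = b := by
  have hb0 : lamSq 2 (((b : closedBall (0 : EuclideanSpace ℝ (Fin 4)) 1) : EuclideanSpace ℝ (Fin 4))) = 0 :=
    BeltPageClause.lamSq_eq_zero_of_not_mem_range_jA D j b (hy ▸ hdeep)
  have hb1 : ‖(((b : closedBall (0 : EuclideanSpace ℝ (Fin 4)) 1) : EuclideanSpace ℝ (Fin 4)))‖ = 1 :=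
    BeltPageClause.norm_eq_one_of_jB_mem_boundary D j b (hy ▸ G₀_incl_mem_boundary bX G₀ y)
  exact exists_beltCirclePt_eq (muSq_eq_one_of_lamSq_eq_zero hb0 hb1)

/-- **Every belt-circle point is a deep boundary point over a unique `y ∈ ∂X₀`.**
[cite: Kosinski1993, VI §6] -/
theorem exists_carrier_of_beltCirclePt (j : Fin n) (θ : sphere (0 : EuclideanSpace ℝ (Fin 2)) 1) :
    ∃ y : bX.carrier, G₀ (bX.incl y) = D.jB j (beltCirclePt θ) ∧ G₀ (bX.incl y) ∉ range D.jA := by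
  have h2 : D.jB j (beltCirclePt θ) ∈ (𝓡∂ 4).boundary X := isBoundaryPoint_jB_beltCirclePt D j θ
  have h3 : G₀.symm (D.jB j (beltCirclePt θ)) ∈ (𝓡∂ 4).boundary X₀ := by
    have h4 := Diffeomorph.preimage_boundary (I := 𝓡∂ 4) (I' := 𝓡∂ 4) (M := X₀) (N := X) (n := ∞)
      (by simp) G₀
    rw [← h4, mem_preimage, Diffeomorph.apply_symm_apply]
    exact h2
  rw [← bX.range_incl] at h3
  obtain ⟨y, hy⟩ := h3
  have hy' : G₀ (bX.incl y) = D.jB j (beltCirclePt θ) := by rw [hy, Diffeomorph.apply_symm_apply]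
  refine ⟨y, hy', ?_⟩
  rw [hy']
  rintro ⟨a, ha⟩
  exact jA_ne_jB_beltCirclePt D j a θ ha

/-- The point of `∂X₀` over a point of `X` is unique. [folklore] -/
theorem carrier_unique {y y' : bX.carrier} (e : G₀ (bX.incl y) = G₀ (bX.incl y')) : y = y' :=
  bX.injective_incl (G₀.injective e)

end Deep

/-! ## §2 The level of the belt page angle -/

section Level

variable {g n : ℕ} {h : Fin n → HandleAttachingMap 3 2 (Base g)}
  {X₀ : Type} [TopologicalSpace X₀] [ChartedSpace (EuclideanHalfSpace 4) X₀]
  (bX : BoundaryData (𝓡∂ 4) X₀ (𝓡 3)) (Ψ : bX.carrier → (bBase g).carrier)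
  {X : Type} [TopologicalSpace X] [ChartedSpace (EuclideanHalfSpace 4) X]
  (G₀ : X₀ ≃ₘ⟮𝓡∂ 4, 𝓡∂ 4⟯ X) (D : MultiAttachmentData h (𝓡∂ 4) X) (d : Fin n → ℂ)

/-- **The level of the belt page angle** (brick H4-1″): under the seam and belt clauses through `G₀`, a
point `y ∈ ∂X₀` with `w (Ψ y) ∈ ℝ_{>0} · d k` (the direction of handle `k`, shared by no other handle) is
either a seam point over the base page of direction `d k` (off the cores, possibly on the binding side),
or a belt-circle point of handle `k`. [cite: Kosinski1993, VI §6] -/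
theorem beltLevel_dichotomy
    (hseam : ∀ (y : bX.carrier) (a : ↥(coresComplement h)), G₀ (bX.incl y) = D.jA a →
      ∃ c : ℝ, 0 < c ∧ w g ((bBase g).incl (Ψ y)).1 = (c : ℂ) * w g (a : Base g).1)
    (hbelt : ∀ (y : bX.carrier) (j : Fin n) (b : ↥(beltPiece 3 2)), G₀ (bX.incl y) = D.jB j b →
      G₀ (bX.incl y) ∉ range D.jA →
      ∃ c : ℝ, 0 < c ∧ w g ((bBase g).incl (Ψ y)).1 = (c : ℂ) * d j)
    (hd : ∀ j, ‖d j‖ = 1) (k : Fin n) (hdk : ∀ j, j ≠ k → d j ≠ d k) (y : bX.carrier)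
    (hy : ∃ c : ℝ, 0 < c ∧ w g ((bBase g).incl (Ψ y)).1 = (c : ℂ) * d k) :
    (∃ a : ↥(coresComplement h), G₀ (bX.incl y) = D.jA a ∧
      (∃ c : ℝ, 0 < c ∧ w g (a : Base g).1 = (c : ℂ) * d k) ∧ (a : Base g) ∈ (𝓡∂ 4).boundary (Base g)) ∨
    (∃ θ : sphere (0 : EuclideanSpace ℝ (Fin 2)) 1, G₀ (bX.incl y) = D.jB k (beltCirclePt θ) ∧
      G₀ (bX.incl y) ∉ range D.jA) := by
  obtain ⟨c, hc, hcw⟩ := hy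
  rcases D.mem_range_or (G₀ (bX.incl y)) with ⟨a, ha⟩ | ⟨j, b, hb⟩
  · -- seam point
    left
    obtain ⟨c'', hc'', hw⟩ := hseam y a ha.symm
    refine ⟨a, ha.symm, ⟨c / c'', div_pos hc hc'', ?_⟩, mem_boundary_of_G₀_incl_eq_jA bX G₀ D ha.symm⟩
    have hne : (c'' : ℂ) ≠ 0 := by exact_mod_cast hc''.ne'
    have e1 : w g (a : Base g).1 = (c'' : ℂ)⁻¹ * w g ((bBase g).incl (Ψ y)).1 := by
      rw [hw, ← mul_assoc, inv_mul_cancel₀ hne, one_mul]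
    rw [e1, hcw, ← mul_assoc]
    congr 1
    push_cast
    field_simp
  · by_cases hdeep : G₀ (bX.incl y) ∈ range D.jA
    · -- a glued handle point is a seam point as well
      left
      obtain ⟨a, ha⟩ := hdeep
      obtain ⟨c'', hc'', hw⟩ := hseam y a ha.symm
      refine ⟨a, ha.symm, ⟨c / c'', div_pos hc hc'', ?_⟩, mem_boundary_of_G₀_incl_eq_jA bX G₀ D ha.symm⟩
      have hne : (c'' : ℂ) ≠ 0 := by exact_mod_cast hc''.ne'
      have e1 : w g (a : Base g).1 = (c'' : ℂ)⁻¹ * w g ((bBase g).incl (Ψ y)).1 := by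
        rw [hw, ← mul_assoc, inv_mul_cancel₀ hne, one_mul]
      rw [e1, hcw, ← mul_assoc]
      congr 1
      push_cast
      field_simp
    · -- a deep point: of handle `k` (directions), on the belt circle (§1)
      right
      obtain ⟨c', hc', hc'w⟩ := hbelt y j b hb.symm hdeep
      have hjk : j = k := by
        by_contra hjk
        exact hdk j hjk (eq_of_pos_mul_unit_eq hc' hc (hd j) (hd k) (hc'w.symm.trans hcw))
      subst hjk
      obtain ⟨θ, hθ⟩ := exists_beltCirclePt_of_deep bX G₀ D hb.symm hdeep
      exact ⟨θ, by rw [hθ]; exact hb.symm, hdeep⟩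

/-- **Sub-goal `helper_beltLevel_dichotomy` of stub `stub_M2geo`** (N1 ▸ `node_N1_move` ▸ (d) N1-mono, brick
H4-1″; wave 7, lead c5).  THE LEVEL OF THE BELT PAGE ANGLE: for the telescope of `node_N1_move` with the seam
and belt clauses through `G₀` and a handle `k` whose direction is not shared, every `y ∈ ∂X₀` with
`w (Ψ y) ∈ ℝ_{>0} · d k` is a seam point `G₀ (bX.incl y) = D.jA a` with `w a ∈ ℝ_{>0} · d k`, `a ∈ ∂ Base g`,
or a belt-circle point `G₀ (bX.incl y) = D.jB k (beltCirclePt θ) ∉ range D.jA` of handle `k`.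
[cite: Kosinski1993, VI §6] -/
theorem helper_beltLevel_dichotomy : ∀ (g n : ℕ) (X₀ : Type) [TopologicalSpace X₀] [ChartedSpace (EuclideanHalfSpace 4) X₀] (bX : Literature.Topology.FourManifolds.BoundaryData (𝓡∂ 4) X₀ (𝓡 3)) (Ψ : bX.carrier → (Literature.Topology.FourManifolds.LefschetzBase.bBase g).carrier) (X : Type) [TopologicalSpace X] [ChartedSpace (EuclideanHalfSpace 4) X] (G₀ : X₀ ≃ₘ⟮𝓡∂ 4, 𝓡∂ 4⟯ X) (h : Fin n → Literature.Topology.FourManifolds.HandleAttachingMap 3 2 (Literature.Topology.FourManifolds.LefschetzBase.Base g)) (D : Literature.Topology.FourManifolds.HandleAttachingMap.MultiAttachmentData h (𝓡∂ 4) X) (d : Fin n → ℂ) (k : Fin n), (∀ j, ‖d j‖ = 1) → (∀ j, j ≠ k → d j ≠ d k) → (∀ (y : bX.carrier) (a : ↥(Literature.Topology.FourManifolds.HandleAttachingMap.coresComplement h)), G₀ (bX.incl y) = D.jA a → ∃ c : ℝ, 0 < c ∧ Literature.Topology.FourManifolds.LefschetzBase.w g ((Literature.Topology.FourManifolds.LefschetzBase.bBase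 g).incl (Ψ y)).1 = (c : ℂ) * Literature.Topology.FourManifolds.LefschetzBase.w g (a : Literature.Topology.FourManifolds.LefschetzBase.Base g).1) → (∀ (y : bX.carrier) (j : Fin n) (b : ↥(Literature.Topology.FourManifolds.beltPiece 3 2)), G₀ (bX.incl y) = D.jB j b → G₀ (bX.incl y) ∉ Set.range D.jA → ∃ c : ℝ, 0 < c ∧ Literature.Topology.FourManifolds.LefschetzBase.w g ((Literature.Topology.FourManifolds.LefschetzBase.bBase g).incl (Ψ y)).1 = (c : ℂ) * d j) → ∀ (y : bX.carrier), (∃ c : ℝ, 0 < c ∧ Literature.Topology.FourManifolds.LefschetzBase.w g ((Literature.Topology.FourManifolds.LefschetzBase.bBase g).incl (Ψ y)).1 = (c : ℂ) * d k) → (∃ a : ↥(Literature.Topology.FourManifolds.HandleAttachingMap.coresComplement h), G₀ (bX.incl y) = D.jA a ∧ (∃ c : ℝ, 0 < c ∧ Literature.Topology.FourManifolds.LefschetzBase.w g (a : Literature.Topology.FourManifolds.LefschetzBase.Base g).1 = (c : ℂ) * d k) ∧ (a : Literature.Topology.FourManifolds.LefschetzBase.Base g) ∈ (𝓡∂ 4).boundary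 (Literature.Topology.FourManifolds.LefschetzBase.Base g)) ∨ (∃ θ : Metric.sphere (0 : EuclideanSpace ℝ (Fin 2)) 1, G₀ (bX.incl y) = D.jB k (Summit.SmoothPoincare4.SmoothPoincare4.Theorems.AcyclicBisectionExists.ModpBraidOrbits.beltCirclePt θ) ∧ G₀ (bX.incl y) ∉ Set.range D.jA) := by
  intro g n X₀ _ _ bX Ψ X _ _ G₀ h D d k hd hdk hseam hbelt y hy
  exact beltLevel_dichotomy bX Ψ G₀ D d hseam hbelt hd k hdk y hy

end Level

end Summit.SmoothPoincare4.SmoothPoincare4.Theorems.AcyclicBisectionExists.ModpBraidOrbits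

end
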